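import Summits.Ventures.HodgeRepro2.T6N41PlaceInert

/-!
# T6N41PlaceSplit — the split-place carriers of the placement (P7) (Tier 6, M2; definition lane; owner t6-p4)

Layer 3 of the placement: the objects of TIER5 §N4.1 (P7) at a finite place `v ∉ S` of `F` SPLIT in `E`
(`E_v = E_{𝔓₁} × E_{𝔓₂} = F_v × F_v`, the two primes `𝔓₁ = w`, `𝔓₂ = w̄` of `E` above `v`; `U(W_{A,v}) ≅ GL₂(F_v)`
and `U(V′_v) ≅ GL₁(F_v) = F_v^×` through the first factor — TIER5 §N4.1.9 (A′-1), Gan–Takeda §2 / Harris II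
§2.2.9), over the inert datum `In : InertDatum Pl` whose carriers `RepU v`, `π v`, `twist`, `ξV`, `γD`, `ωt`,
`thetaLift` are reused:
* `splitPlace v` («`v` is split in `E`»), the two primes `p₁ v`, `p₂ v` above a split `v` (distinct, the whole fibre);
* `psF v a b` — the nonramified principal series `I(χ₁, χ₂)` of `GL₂(F_v)` with Satake parameters `(a, b)`, read
  on `U(W_{A,v})` through the isomorphism of (A′-1); `twistF v ρ ξ = ρ ⊗ (ξ ∘ det)`; `ωc v ρ` the central character
  of `ρ` at `ϖ_v` (the centre `E¹_v ≅ F_v^×` of `U(W_{A,v})`);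
* `θII v β` — Mínguez's type-II theta lift `θ(β) = π′` (Théorème 1 (1), the unique `π′` of `G_2 = GL₂(F_v)` with
  `Hom_{G_1 × G_2}(ω_{1,2}, β ⊗ π′) ≠ 0`) of the unramified character `β` of `G_1 = GL₁(F_v)` with `β(ϖ_v) = β`,
  for the model (1.4) of `ω_{1,2}`;
* `Θ v β` — the DATUM's local theta lift `Θ_{V′_v → W_{A,v}}(β)` (the Weil representation
  `ω_{W_A, V′, χ, v}` of the unitary dual pair with the datum's splitting characters `(χ_{V′}, χ_{W_A})` and `ψ_v`)
  of the unramified character `β` of `U(V′_v) = F_v^×` with `β(ϖ_v) = β`; `βv v = β′_v(ϖ_v)` the value of the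
  datum's character `β′` (unitary, unramified at `v ∉ S`);
* `μ₁ v`, `μ₂ v` — the values at `ϖ_v` of the two unramified characters by which the datum's Weil representation
  differs from Mínguez's: `ω_{W_A, V′, χ, v} ≅ ω_{1,2} ⊗ (μ₁ ⊠ μ₂ ∘ det)` (TIER5 §N4.1.9 (A′-1));
* `ι₁ v`, `ι₂ v` — the identifications of a representation of `U(W_{A,v}) ≅ GL₂(F_v)` with a representation of
  `GL₂(E_{𝔓₁}) = GL₂(F_v)` (the same group) and with one of `GL₂(E_{𝔓₂}) = GL₂(F_v)` through the CONTRAGREDIENT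
  (E10 of TIER5 §N4.1: `BC(π_v) = (π_v, π_v^∨)` on `GL₂(E_v) = GL₂(F_v) × GL₂(F_v)` — the Galois conjugation
  swaps the two factors and `g ↦ ᵗḡ⁻¹` on the second).

The DEFINITIONAL fields say what the datum's objects are (`π_Θ`: `π_v = Θ_{V′→W_A}(β′_v)`, (N0.3) D3, on the
carriers; `η₂_def`, `η₁_def`: `η₂′ = γ_D χ_V`, `η₁′ = ω̃_π γ_D⁻¹ χ_V` at the two primes, TIER5 §N4.1.9 (A″);
`ωt_p₁`, `ωt_p₂`: `ω̃_π(z) = ω_π(z / z̄)` (E4) at the uniformisers `(ϖ, 1)` and `(1, ϖ)` of `E_v = F_v × F_v` —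
`z / z̄ = (ϖ, ϖ⁻¹)` resp. `(ϖ⁻¹, ϖ)`, i.e. `ω_π(ϖ)` resp. `ω_π(ϖ)⁻¹` on the centre `E¹_v ≅ F_v^×`).  The ELEMENTARY
fields are the reductions (A′-1)–(A′-3) and (c2)–(c5) of TIER5 §N4.1.9 in the carrier's words: `Θ_eq` (the
twist rule `Θ_{ω ⊗ (μ₁ ⊠ μ₂∘det)}(β) = Θ_ω(β μ₁⁻¹) ⊗ μ₂∘det` — Hom-adjunction + Mínguez's uniqueness, (A′-2)),
`twistF_ps` and `ι₁_ps`, `ι₂_ps` (`I(χ₁, χ₂) ⊗ ξ∘det = I(χ₁ξ, χ₂ξ)`; `I(χ₁, χ₂)^∨ = I(χ₁⁻¹, χ₂⁻¹)` — Bump §4.5),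
`ωc_ps` (the central character of `I(χ₁, χ₂)` is `χ₁χ₂`), `μ₁_unit` (two unitary sections of one central
`ℂ^×`-extension differ by a UNITARY character), `βv_unit` (`β′` is a unitary automorphic character of `U(V′)`),
`γD_p₂` (`γ_D|_{𝔸_F^×} = ω_{E/F}` — GR91 Remark (1) — is trivial at a split `v`: `γ_D(𝔓₁) γ_D(𝔓₂) = γ_D(ϖ_v) = 1`).
The two COMPAT fields `BCχ_p₁`, `BCχ_p₂` identify LR's `BC(π_v) ⊗ χ_{V,v}` at a split place with
`(π_v ⊗ χ_{V,𝔓₁}, π_v^∨ ⊗ χ_{V,𝔓₂})` (E10; the Satake transfer under the standard embedding at a split place) —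
class IR, like `InertDatum.BCχ_eq`.

What is NOT a field: the identity `γ_D(𝔓₁) = μ₂` — (A″κ) of TIER5 §N4.1.9 (c6) / §N4.1.10, «`μ₂` is the
`w`-component of the global character `γ_D`» — stays the ONE residual binder `hκ` of
`T6N41PlaceSplitMain.satake_split` (class AD, the lead's ruling STATUS l. 4706 (3)).

§8(d): uses an L-value-free non-vanishing device: NO.
-/

namespace Summit.Ventures.HodgeRepro2.T6

/-- The split-place carriers of the placement over the inert datum `In`.  Fields are DATA, definitional links,
the elementary reductions (A′-1)–(A′-3) / (c2)–(c5) of TIER5 §N4.1.9 in the carrier's words, and two compat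
fields; the printed theorem (Mínguez 2008 Théorème 1 (2)) is the display of `T6N41PlaceSplitHyp.lean`. -/
structure SplitDatum {ι : Type*} {D : DoublingLDatum ι} {Pl : PlacementDatum D} (In : InertDatum Pl) where
  /-- «`v` is split in `E`»: `E ⊗_F F_v = F_v × F_v`, two primes of `E` above `v` -/
  splitPlace : ι → Prop
  /-- the first prime `𝔓₁ = w` above a split `v` (the place `w` of `E` chosen to identify `U(W_{A,v})` with
  `GL₂(F_v)` — GR91 p. 471 l. 8 «by choosing a place w of E above v», TIER5 §N4.1.9 (c4)) -/
  p₁ : ι → Pl.κ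
  /-- the second prime `𝔓₂ = w̄` above a split `v` -/
  p₂ : ι → Pl.κ
  /-- `𝔓₁` lies above `v` -/
  b_p₁ : ∀ v, splitPlace v → Pl.b (p₁ v) = v
  /-- `𝔓₂` lies above `v` -/
  b_p₂ : ∀ v, splitPlace v → Pl.b (p₂ v) = v
  /-- the two primes are distinct -/
  p₁_ne_p₂ : ∀ v, splitPlace v → p₁ v ≠ p₂ v
  /-- `{𝔓₁, 𝔓₂}` is the whole fibre of a split `v` -/
  fiber_split : ∀ 𝔓, splitPlace (Pl.b 𝔓) → 𝔓 = p₁ (Pl.b 𝔓) ∨ 𝔓 = p₂ (Pl.b 𝔓)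
  /-- a split prime is not inert -/
  not_inert : ∀ 𝔓, splitPlace (Pl.b 𝔓) → ¬ In.inert 𝔓
  /-- the nonramified principal series `I(χ₁, χ₂)` of `GL₂(F_v)` with Satake parameters `(χ₁(ϖ), χ₂(ϖ)) = (a, b)`,
  as a representation of `U(W_{A,v}) ≅ GL₂(F_v)` ((A′-1)) -/
  psF : ∀ v, ℂˣ → ℂˣ → In.RepU v
  /-- the twist `ρ ⊗ (ξ ∘ det)` of a representation of `U(W_{A,v}) ≅ GL₂(F_v)` by the unramified character of
  `F_v^×` with `ξ(ϖ) = ξ` -/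
  twistF : ∀ v, In.RepU v → ℂˣ → In.RepU v
  /-- [elementary; Bump §4.5] `I(χ₁, χ₂) ⊗ (ξ ∘ det) = I(χ₁ ξ, χ₂ ξ)` on Satake parameters -/
  twistF_ps : ∀ v (a b ξ : ℂˣ), twistF v (psF v a b) ξ = psF v (a * ξ) (b * ξ)
  /-- the central character of a representation of `U(W_{A,v})`, evaluated at the uniformiser `ϖ_v` of the centre
  `E¹_v ≅ F_v^×` (`(ϖ, ϖ⁻¹) ↦ ϖ`) -/
  ωc : ∀ v, In.RepU v → ℂˣ
  /-- [elementary; Bump §4.5] the central character of `I(χ₁, χ₂)` is `χ₁ χ₂` -/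
  ωc_ps : ∀ v (a b : ℂˣ), ωc v (psF v a b) = a * b
  /-- Mínguez's type-II theta lift `θ(β)` (Théorème 1 (1): the unique `π′` of `G_2 = GL₂(F_v)` with
  `Hom_{G_1 × G_2}(ω_{1,2}, β ⊗ π′) ≠ 0`, for the model (1.4) of `ω_{1,2}`) of the unramified character `β` of
  `G_1 = GL₁(F_v)` with `β(ϖ_v) = β`, as a representation of `U(W_{A,v}) ≅ GL₂(F_v)` -/
  θII : ∀ v, ℂˣ → In.RepU v
  /-- the datum's local theta lift `Θ_{V′_v → W_{A,v}}(β)` (the Weil representation `ω_{W_A, V′, χ, v}` of the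
  unitary dual pair `(U(W_{A,v}), U(V′_v))` with the datum's splitting characters and `ψ_v`) of the unramified
  character `β` of `U(V′_v) = F_v^×` with `β(ϖ_v) = β` -/
  Θ : ∀ v, ℂˣ → In.RepU v
  /-- `β′_v(ϖ_v)`, the value at the uniformiser of the datum's character `β′` of `U(V′)` (unramified at `v ∉ S`) -/
  βv : ι → ℂˣ
  /-- [elementary] `β′` is a unitary automorphic character of `U(V′)(𝔸_F)`: `‖β′_v(ϖ)‖ = 1` -/
  βv_unit : ∀ v, splitPlace v → v ∉ D.S → ‖(βv v : ℂ)‖ = 1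
  /-- [definitional (N0.3) D3 on the carriers] at a split `v ∉ S`, «`π_v` is the theta lift of `β′_v`» says
  `π_v = Θ_{V′_v → W_{A,v}}(β′_v)` -/
  π_Θ : ∀ v, splitPlace v → v ∉ D.S → In.thetaLift v → In.π v = Θ v (βv v)
  /-- `μ₁(ϖ_v)`: the `GL₁`-side character of TIER5 §N4.1.9 (A′-1) -/
  μ₁ : ι → ℂˣ
  /-- `μ₂(ϖ_v)`: the `GL₂`-side character of TIER5 §N4.1.9 (A′-1) (`μ₂ = λ_{D,w} κ_v⁻¹`, §N4.1.9 (c5)) -/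
  μ₂ : ι → ℂˣ
  /-- [elementary (A′-1)] the two sections of the central `ℂ^×`-extension of `GL₁(F_v) × GL₂(F_v)` (the datum's
  and Mínguez's) are unitary, so the character `μ₁ ⊠ μ₂∘det` they differ by is unitary: `‖μ₁(ϖ)‖ = 1` -/
  μ₁_unit : ∀ v, splitPlace v → v ∉ D.S → ‖(μ₁ v : ℂ)‖ = 1
  /-- [elementary (A′-1)+(A′-2)] `ω_{W_A, V′, χ, v} ≅ ω_{1,2} ⊗ (μ₁ ⊠ μ₂∘det)` and the twist rule
  `Θ_{ω ⊗ (μ₁ ⊠ μ₂∘det)}(β) = Θ_ω(β μ₁⁻¹) ⊗ μ₂∘det` (Hom-adjunction + Mínguez's uniqueness, Théorème 1 (1)):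
  the datum's lift of `β` is Mínguez's lift of `β μ₁⁻¹` twisted by `μ₂ ∘ det` -/
  Θ_eq : ∀ v, splitPlace v → v ∉ D.S → ∀ β : ℂˣ, Θ v β = twistF v (θII v (β * (μ₁ v)⁻¹)) (μ₂ v)
  /-- a representation of `U(W_{A,v}) ≅ GL₂(F_v)` as a representation of `GL₂(E_{𝔓₁}) = GL₂(F_v)` (the first
  factor of `GL₂(E_v) = GL₂(F_v) × GL₂(F_v)`) -/
  ι₁ : ∀ v, In.RepU v → Pl.RepGL (p₁ v)
  /-- a representation of `U(W_{A,v}) ≅ GL₂(F_v)` as a representation of `GL₂(E_{𝔓₂}) = GL₂(F_v)` through the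
  CONTRAGREDIENT (the second factor, on which the Galois conjugation acts by `g ↦ ᵗḡ⁻¹`) -/
  ι₂ : ∀ v, In.RepU v → Pl.RepGL (p₂ v)
  /-- [elementary] `ι₁` is the identity on Satake parameters -/
  ι₁_ps : ∀ v (a b : ℂˣ), ι₁ v (psF v a b) = Pl.ps (p₁ v) a b
  /-- [elementary; Bump §4.5: `I(χ₁, χ₂)^∨ = I(χ₁⁻¹, χ₂⁻¹)`] `ι₂` inverts the Satake parameters -/
  ι₂_ps : ∀ v (a b : ℂˣ), ι₂ v (psF v a b) = Pl.ps (p₂ v) a⁻¹ b⁻¹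
  /-- [compat; class IR; E10] at a split `v ∉ S`, the `E_{𝔓₁}`-component of LR's `BC(π_v) ⊗ χ_{V,v}` is
  `π_v ⊗ χ_{V,𝔓₁}` -/
  BCχ_p₁ : ∀ v, splitPlace v → v ∉ D.S →
    Pl.BCχ (p₁ v) = In.twist (p₁ v) (ι₁ v (In.π v)) (In.ξV (p₁ v))
  /-- [compat; class IR; E10] at a split `v ∉ S`, the `E_{𝔓₂}`-component of LR's `BC(π_v) ⊗ χ_{V,v}` is
  `π_v^∨ ⊗ χ_{V,𝔓₂}` -/
  BCχ_p₂ : ∀ v, splitPlace v → v ∉ D.S →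
    Pl.BCχ (p₂ v) = In.twist (p₂ v) (ι₂ v (In.π v)) (In.ξV (p₂ v))
  /-- [definitional E4] `ω̃_π(ϖ_{𝔓₁}) = ω_π((ϖ, 1) / (1, ϖ)) = ω_π((ϖ, ϖ⁻¹)) = ω_π(ϖ)` on the centre
  `E¹_v ≅ F_v^×` -/
  ωt_p₁ : ∀ v, splitPlace v → v ∉ D.S → In.ωt (p₁ v) = ωc v (In.π v)
  /-- [definitional E4] `ω̃_π(ϖ_{𝔓₂}) = ω_π((1, ϖ) / (ϖ, 1)) = ω_π((ϖ⁻¹, ϖ)) = ω_π(ϖ)⁻¹` -/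
  ωt_p₂ : ∀ v, splitPlace v → v ∉ D.S → In.ωt (p₂ v) = (ωc v (In.π v))⁻¹
  /-- [elementary F3; GR91 Remark (1)] `γ_D|_{𝔸_F^×} = ω_{E/F}` is trivial at a split `v`:
  `γ_D(𝔓₁) γ_D(𝔓₂) = γ_D(ϖ_v) = 1` -/
  γD_p₂ : ∀ v, splitPlace v → v ∉ D.S → In.γD (p₂ v) = (In.γD (p₁ v))⁻¹
  /-- [definitional (A″)] `η₂′ = γ_D χ_V` at every prime above a split `v ∉ S` -/
  η₂_def : ∀ 𝔓, splitPlace (Pl.b 𝔓) → Pl.b 𝔓 ∉ D.S → Pl.η₂ 𝔓 = In.γD 𝔓 * In.ξV 𝔓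
  /-- [definitional (A″)] `η₁′ = ω̃_π γ_D⁻¹ χ_V` at every prime above a split `v ∉ S` -/
  η₁_def : ∀ 𝔓, splitPlace (Pl.b 𝔓) → Pl.b 𝔓 ∉ D.S → Pl.η₁ 𝔓 = In.ωt 𝔓 * (In.γD 𝔓)⁻¹ * In.ξV 𝔓

namespace SplitDatum

variable {ι : Type*} {D : DoublingLDatum ι} {Pl : PlacementDatum D} {In : InertDatum Pl} (Sp : SplitDatum In)

/-- At a split `v ∉ S` the Hecke values at `𝔓₂` are the inverses of those at `𝔓₁` up to the splitting
character: `η₂′(𝔓₂) = γ_D(𝔓₁)⁻¹ χ_V(𝔓₂)`. -/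
theorem η₂_p₂ (v : ι) (hv : Sp.splitPlace v) (hS : v ∉ D.S) :
    Pl.η₂ (Sp.p₂ v) = (In.γD (Sp.p₁ v))⁻¹ * In.ξV (Sp.p₂ v) := by
  have hb := Sp.b_p₂ v hv
  rw [Sp.η₂_def (Sp.p₂ v) (by rw [hb]; exact hv) (by rw [hb]; exact hS), Sp.γD_p₂ v hv hS]

end SplitDatum

end Summit.Ventures.HodgeRepro2.T6
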